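/-
Copyright (c) 2026 The HodgeCM formalization project (cell hodgecm-mathlib, squad K2·E4). Prover seat hodgecm-mathlib-K2E4-p10 (g4).
Released under Apache 2.0 license as described in the file LICENSE.
-/
import Literature.Analysis.Complex.HolomorphicParametricIntegral     -- ★ `differentiableOn_integral_of_dominated` (holomorphy of dominated parameter integrals)
import Literature.NumberTheory.Automorphic.PairLFunctionPolesRealMoments  -- ★ `rpow_le_rpow_add_rpow_of_le_of_le` (two-sided domination), template `differentiableOn_integral_mul_cpow`
import Mathlib.Analysis.SpecialFunctions.Pow.Deriv
import Mathlib.Analysis.SpecialFunctions.Pow.Continuity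
import Mathlib.Analysis.Analytic.IsolatedZeros
import Mathlib.Analysis.Complex.CauchyIntegral
import Mathlib.Analysis.Complex.Convex
import Mathlib.Analysis.Meromorphic.Basic
import Mathlib.MeasureTheory.Function.SpecialFunctions.Basic
import HarnessLib

/-!
# K2·E1 — `K2E1PowerMomentHolomorphy` (FILE A of «W5-B»): MELLIN-TYPE MOMENTS `z ↦ ∫ w(x)^{±z} dm` ARE HOLOMORPHIC ON THEIR HALF-PLANE OF CONVERGENCE;
# THE IDENTITY THEOREM FROM THE REAL AXIS; THE `F(z)∕(z − 1)` CONTINUATION PACKAGE (rank-free analysis)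

Track B ∕ K2-LIT, crux h413 = `stmt-HodgeConjecture-24833`, route of record `HCCMUnconditional`; cell `hodgecm-mathlib`, squad K2, ENGINE E1 (campaign «EIS-WHITTAKER-2», rung
«W5-B»: the `c̃` input of ★ W5-A p858272 `K2E1SphericalEisensteinContinuationU2`).  Prover seat `hodgecm-mathlib-K2E4-p10` (g4); deal of K2E1-plan (g4) 2026-09-04T07:29:46Z
(deck #1, taken 07:35:08Z).  THEOREMS ONLY (no `def`, no `instance`, no notation, no named-fact hypothesis, no `sorry`); lane `--supports stmt-HodgeConjecture-24833 --as helper`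
(count-neutral).  Closes no socket.  RANK-FREE: nothing here mentions `U(1,1)`; FILE B (`K2E1IntertwiningLocalFactorIntegrableU2`) and FILE C (the head
`K2E1SphericalConstantTermContinuationU2`) instantiate it at the intertwining scalar `c(z) = ν(𝓕)⁻¹·∫_{N(𝔸)} H(w₀v)^z dν`, its archimedean mean `c_∞(z)` and its local means `a_v(z)`.

THE MATHEMATICS [Titchmarsh1939, §1.51, §2.8 (analytic parameter integrals), §4.1; CogdellAnalyticTheory2004, §4.2; Garrett2018, §1.10, §2.B].
* §1 **`differentiableOn_integral_ofReal_cpow`** ∕ **`…_neg`**: for a measurable `w > 0` on a measure space `(X, m)` with `∫ w^σ dm < ∞` (resp. `∫ w^{−σ} dm < ∞`) for every real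
  `σ > a`, the moment `z ↦ ∫ w(x)^z dm` (resp. `∫ w(x)^{−z} dm`) is holomorphic on `{Re z > a}` — ★ `Literature.Analysis.Complex.differentiableOn_integral_of_dominated` with the two-sided
  majorant `w^{σ₀−R} + w^{σ₀+R}`, `R = (σ₀ − a)∕2` (the threshold-`a` edition of ★ `Literature.NumberTheory.Automorphic.differentiableOn_integral_mul_cpow`, which is `a = 1`, `G`-weighted).
* §2 **`integral_ofReal_cpow_ofReal`** ∕ **`…_neg_ofReal`**: at a real point `z = σ` the complex moment is the real moment cast to `ℂ`; **`integral_rpow_pos`**: it is `> 0` when `m ≠ 0`.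
* §3 **`eqOn_re_gt_of_forall_ofReal`**: two functions holomorphic on `{Re z > a}` that agree at every real `σ > a` agree on the half-plane (identity theorem, accumulation at `a + 1`).
* §4 **`continuation_package_div_sub_one`**: for `F` holomorphic on an open `U ∋ 1`, `c̃(z) := F(z)∕(z − 1)` is meromorphic on `U`, holomorphic on `U ∖ {1}`, and `(z − 1)·c̃(z) → F(1)` on
  `𝓝[≠] 1` — exactly the shape `hc̃mer ∕ hc̃hol ∕ hc̃res` consumed by ★ W5-A `spherical_continuation_of_inputs`.
HONEST LABEL: HC_CM is proved only modulo the 7 printed citations (2 remaining named inputs: hLiu418 = `stmt-HodgeConjecture-24832`, h413 = `stmt-HodgeConjecture-24833`) until rung 0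
closes; this file asserts no named fact and closes no socket; count-neutral.

## References
* [Titchmarsh1939] E. C. Titchmarsh, *The Theory of Functions*, 2nd ed. (1939), §1.51, §2.8, §4.1.
* [CogdellAnalyticTheory2004] J. Cogdell, *Lectures on L-functions, converse theorems, and functoriality for GLₙ* (2004), §4.2.
* [Garrett2018] P. Garrett, *Modern Analysis of Automorphic Forms by Example* 1 (2018), §1.10, §2.B.
-/

set_option autoImplicit false
-- the mandated namespace repeats the single-problem summit's segment (`HodgeConjecture.HodgeConjecture`)
set_option linter.dupNamespace false

noncomputable section

open MeasureTheory Metric Set Filter Topology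

namespace Summit.HodgeConjecture.HodgeConjecture.Cruxes.H413.K2E1PowerMomentHolomorphy

variable {X : Type*} [MeasurableSpace X] {m : Measure X} {w : X → ℝ}

/-! ## §1 Moments are holomorphic on their half-plane of absolute convergence -/

/-- In the ball `‖z − z₀‖ < R` the real part stays in `[Re z₀ − R, Re z₀ + R]`. [folklore] -/
theorem re_mem_Icc_of_mem_ball {z₀ z : ℂ} {R : ℝ} (hz : z ∈ ball z₀ R) : z₀.re - R ≤ z.re ∧ z.re ≤ z₀.re + R := by
  rw [Metric.mem_ball, dist_eq_norm] at hz
  have h1 : |z.re - z₀.re| ≤ ‖z - z₀‖ := by simpa [Complex.sub_re] using Complex.abs_re_le_norm (z - z₀)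
  have h2 := abs_le.mp (h1.trans hz.le)
  constructor <;> linarith [h2.1, h2.2]

/-- **MOMENTS ARE HOLOMORPHIC.**  If `w > 0` is measurable and `∫ w^σ dm < ∞` for every real `σ > a`, then `z ↦ ∫ w(x)^z dm(x)` is holomorphic on `{Re z > a}`: near `z₀` the integrand is
dominated by `w^{σ₀−R} + w^{σ₀+R}`, `R = (Re z₀ − a)∕2` (★ `Literature.Analysis.Complex.differentiableOn_integral_of_dominated`). [cite: Titchmarsh1939, §2.8] [cite: CogdellAnalyticTheory2004, §4.2] -/
theorem differentiableOn_integral_ofReal_cpow (hw : Measurable w) (hw0 : ∀ x, 0 < w x) {a : ℝ}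
    (hint : ∀ σ : ℝ, a < σ → Integrable (fun x => w x ^ σ) m) :
    DifferentiableOn ℂ (fun z => ∫ x, ((w x : ℝ) : ℂ) ^ z ∂m) {z : ℂ | a < z.re} := by
  refine Literature.Analysis.Complex.differentiableOn_integral_of_dominated (fun z _ => (hw.complex_ofReal.pow_const z).aestronglyMeasurable)
    (Eventually.of_forall fun x z _ => ?_) ?_
  · exact (differentiableAt_id.const_cpow (Or.inl (Complex.ofReal_ne_zero.mpr (hw0 x).ne'))).differentiableWithinAt
  · intro z₀ hz₀
    have hz₀' : a < z₀.re := hz₀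
    set R : ℝ := (z₀.re - a) / 2 with hR
    have hRpos : 0 < R := by rw [hR]; linarith
    refine ⟨R, hRpos, fun z hz => ?_, fun x => w x ^ (z₀.re - R) + w x ^ (z₀.re + R), (hint _ (by rw [hR]; linarith)).add (hint _ (by rw [hR]; linarith)), ?_⟩
    · show a < z.re
      have := (re_mem_Icc_of_mem_ball hz).1
      rw [hR] at this
      linarith
    · refine Eventually.of_forall fun x z hz => ?_
      rw [Complex.norm_cpow_eq_rpow_re_of_pos (hw0 x)]
      exact Literature.NumberTheory.Automorphic.rpow_le_rpow_add_rpow_of_le_of_le (hw0 x) (re_mem_Icc_of_mem_ball hz).1 (re_mem_Icc_of_mem_ball hz).2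

/-- **MOMENTS WITH NEGATIVE EXPONENT ARE HOLOMORPHIC.**  If `w > 0` is measurable and `∫ w^{−σ} dm < ∞` for every real `σ > a`, then `z ↦ ∫ w(x)^{−z} dm(x)` is holomorphic on `{Re z > a}`
(majorant `w^{−(σ₀+R)} + w^{−(σ₀−R)}`). [cite: Titchmarsh1939, §2.8] [cite: CogdellAnalyticTheory2004, §4.2] -/
theorem differentiableOn_integral_ofReal_cpow_neg (hw : Measurable w) (hw0 : ∀ x, 0 < w x) {a : ℝ}
    (hint : ∀ σ : ℝ, a < σ → Integrable (fun x => w x ^ (-σ)) m) :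
    DifferentiableOn ℂ (fun z => ∫ x, ((w x : ℝ) : ℂ) ^ (-z) ∂m) {z : ℂ | a < z.re} := by
  refine Literature.Analysis.Complex.differentiableOn_integral_of_dominated (fun z _ => (hw.complex_ofReal.pow_const (-z)).aestronglyMeasurable)
    (Eventually.of_forall fun x z _ => ?_) ?_
  · exact (differentiableAt_id.neg.const_cpow (Or.inl (Complex.ofReal_ne_zero.mpr (hw0 x).ne'))).differentiableWithinAt
  · intro z₀ hz₀
    have hz₀' : a < z₀.re := hz₀
    set R : ℝ := (z₀.re - a) / 2 with hR
    have hRpos : 0 < R := by rw [hR]; linarith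
    refine ⟨R, hRpos, fun z hz => ?_, fun x => w x ^ (-(z₀.re + R)) + w x ^ (-(z₀.re - R)), (hint _ (by rw [hR]; linarith)).add (hint _ (by rw [hR]; linarith)), ?_⟩
    · show a < z.re
      have := (re_mem_Icc_of_mem_ball hz).1
      rw [hR] at this
      linarith
    · refine Eventually.of_forall fun x z hz => ?_
      rw [Complex.norm_cpow_eq_rpow_re_of_pos (hw0 x), Complex.neg_re]
      exact Literature.NumberTheory.Automorphic.rpow_le_rpow_add_rpow_of_le_of_le (hw0 x) (neg_le_neg (re_mem_Icc_of_mem_ball hz).2) (neg_le_neg (re_mem_Icc_of_mem_ball hz).1)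

/-! ## §2 Real points: the complex moment is the real moment; positivity -/

/-- **At a real point the complex moment is the real moment**: `∫ w^σ dm` (complex power of the real base `w ≥ 0`) `= ((∫ w^σ dm : ℝ) : ℂ)`. [folklore] -/
theorem integral_ofReal_cpow_ofReal (hw0 : ∀ x, 0 ≤ w x) (σ : ℝ) : (∫ x, ((w x : ℝ) : ℂ) ^ ((σ : ℝ) : ℂ) ∂m) = ((∫ x, w x ^ σ ∂m : ℝ) : ℂ) := by
  rw [← integral_complex_ofReal]
  exact integral_congr_ae (Eventually.of_forall fun x => by simp only [Complex.ofReal_cpow (hw0 x)])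

/-- **At a real point the negative-exponent complex moment is the real moment**: `∫ w^{−σ} dm = ((∫ w^{−σ} dm : ℝ) : ℂ)`. [folklore] -/
theorem integral_ofReal_cpow_neg_ofReal (hw0 : ∀ x, 0 ≤ w x) (σ : ℝ) : (∫ x, ((w x : ℝ) : ℂ) ^ (-((σ : ℝ) : ℂ)) ∂m) = ((∫ x, w x ^ (-σ) ∂m : ℝ) : ℂ) := by
  rw [← integral_complex_ofReal]
  refine integral_congr_ae (Eventually.of_forall fun x => ?_)
  show ((w x : ℝ) : ℂ) ^ (-((σ : ℝ) : ℂ)) = (((w x ^ (-σ) : ℝ)) : ℂ)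
  rw [Complex.ofReal_cpow (hw0 x), Complex.ofReal_neg]

/-- **Real moments of a positive function are positive** (`m ≠ 0`, the moment convergent). [folklore] -/
theorem integral_rpow_pos [NeZero m] (hw0 : ∀ x, 0 < w x) {σ : ℝ} (hint : Integrable (fun x => w x ^ σ) m) : 0 < ∫ x, w x ^ σ ∂m := by
  rw [integral_pos_iff_support_of_nonneg (fun x => (Real.rpow_pos_of_pos (hw0 x) σ).le) hint]
  have hsupp : (Function.support fun x => w x ^ σ) = Set.univ := Set.eq_univ_of_forall fun x => (Real.rpow_pos_of_pos (hw0 x) σ).ne'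
  rw [hsupp]
  exact MeasureTheory.Measure.measure_univ_pos.2 (NeZero.ne m)

/-! ## §3 The identity theorem from the real axis -/

/-- **IDENTITY THEOREM FROM THE REAL AXIS**: if `f`, `g` are holomorphic on the half-plane `{Re z > a}` and `f σ = g σ` for every real `σ > a`, then `f = g` on `{Re z > a}` (the real points
`σ ↓ a + 1` accumulate at `a + 1`; the half-plane is convex, hence preconnected; Mathlib `AnalyticOnNhd.eqOn_of_preconnected_of_frequently_eq`). [cite: Titchmarsh1939, §4.1] -/
theorem eqOn_re_gt_of_forall_ofReal {f g : ℂ → ℂ} {a : ℝ} (hf : DifferentiableOn ℂ f {z : ℂ | a < z.re}) (hg : DifferentiableOn ℂ g {z : ℂ | a < z.re})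
    (h : ∀ σ : ℝ, a < σ → f σ = g σ) : EqOn f g {z : ℂ | a < z.re} := by
  have hUo : IsOpen {z : ℂ | a < z.re} := isOpen_lt continuous_const Complex.continuous_re
  have hmem : (((a + 1 : ℝ)) : ℂ) ∈ {z : ℂ | a < z.re} := by
    show a < (((a + 1 : ℝ)) : ℂ).re
    rw [Complex.ofReal_re]; linarith
  have hfreq : ∃ᶠ z in 𝓝[≠] (((a + 1 : ℝ)) : ℂ), f z = g z := by
    -- along the real points `σ ↓ a + 1`
    have hT : Tendsto (fun σ : ℝ => (σ : ℂ)) (𝓝[Ioi (a + 1)] (a + 1)) (𝓝[≠] (((a + 1 : ℝ)) : ℂ)) := by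
      refine tendsto_nhdsWithin_iff.mpr ⟨?_, ?_⟩
      · exact (Complex.continuous_ofReal.tendsto (a + 1)).mono_left (nhdsWithin_le_nhds (s := Ioi (a + 1)))
      · filter_upwards [self_mem_nhdsWithin] with σ hσ
        have hσ2 : σ ≠ a + 1 := ne_of_gt hσ
        simp only [mem_compl_iff, mem_singleton_iff]
        exact_mod_cast hσ2
    have hev : ∀ᶠ σ : ℝ in 𝓝[Ioi (a + 1)] (a + 1), f (σ : ℂ) = g (σ : ℂ) := by
      filter_upwards [self_mem_nhdsWithin] with σ hσ
      exact h σ (by linarith [(show a + 1 < σ from hσ)])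
    exact hT.frequently hev.frequently
  exact (hf.analyticOnNhd hUo).eqOn_of_preconnected_of_frequently_eq (hg.analyticOnNhd hUo) (convex_halfSpace_re_gt a).isPreconnected hmem hfreq

/-! ## §4 The `F(z)∕(z − 1)` continuation package -/

/-- **THE CONTINUATION PACKAGE.**  For `F` holomorphic on an open `U ∋ 1`, the function `c̃(z) := F(z)∕(z − 1)` is meromorphic on `U`, holomorphic on `U ∖ {1}`, and `(z − 1)·c̃(z) → F(1)`
as `z → 1`, `z ≠ 1` — the shape `hc̃mer ∕ hc̃hol ∕ hc̃res` of ★ W5-A `spherical_continuation_of_inputs` (there with `r = F(1)`). [cite: Titchmarsh1939, §1.51] [cite: Garrett2018, §1.10] -/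
theorem continuation_package_div_sub_one {U : Set ℂ} (hU : IsOpen U) (h1 : (1 : ℂ) ∈ U) {F : ℂ → ℂ} (hF : DifferentiableOn ℂ F U) :
    MeromorphicOn (fun z => F z / (z - 1)) U ∧ DifferentiableOn ℂ (fun z => F z / (z - 1)) (U \ {1}) ∧
      Tendsto (fun z : ℂ => (z - 1) * (F z / (z - 1))) (𝓝[≠] 1) (𝓝 (F 1)) := by
  have hsub : AnalyticOnNhd ℂ (fun z : ℂ => z - 1) U := (analyticOnNhd_id.sub analyticOnNhd_const)
  refine ⟨(hF.analyticOnNhd hU).meromorphicOn.fun_div hsub.meromorphicOn, ?_, ?_⟩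
  · exact (hF.mono fun z hz => hz.1).div (differentiableOn_id.sub (differentiableOn_const _)) fun z hz => sub_ne_zero.2 hz.2
  · have hc : Tendsto F (𝓝[≠] (1 : ℂ)) (𝓝 (F 1)) := ((hF.continuousOn.continuousAt (hU.mem_nhds h1)).tendsto).mono_left nhdsWithin_le_nhds
    refine hc.congr' (eventually_nhdsWithin_of_forall fun z hz => ?_)
    have hz1 : z - 1 ≠ 0 := sub_ne_zero.2 hz
    field_simp

end Summit.HodgeConjecture.HodgeConjecture.Cruxes.H413.K2E1PowerMomentHolomorphy

end
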